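import Literature.GroupTheory.CombinatorialGroupTheory.RandomSclFreeGroupLowerBound
import Literature.GroupTheory.CombinatorialGroupTheory.RandomSclFreeGroupInverseRepeats
import Literature.GroupTheory.CombinatorialGroupTheory.RandomSclFreeGroupDistinctWindows
import Literature.GroupTheory.CombinatorialGroupTheory.RandomSclFreeGroupSharp
import Mathlib.Analysis.Complex.ExponentialBounds
import HarnessLib

/-!
# Random rigidity of scl (Calegari–Walker 2013): proofs, part 8 — the lower tail (constant 1/12)

D. Calegari, A. Walker, *Random rigidity in the free group*, Geom. Topol. 17 (2013)
[CalegariWalker2013], Prop. 5.4: with overwhelming probability a random reduced word `v` of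
length `n` in the commutator subgroup satisfies `scl(v) ≥ (1 − o(1)) n log(2k−1) / (12 L log n)`
(`L > 1`), i.e. `scl(v) · log n / n ≥ log(2k−1)/12 − ε`.

This file prepares the assembly of the deterministic bound `stableCommutatorLength_ge_of_isReduced`
(part 7) with the window statistics of parts 3–4 (`card_filter_inverseWindows_ge_le`,
`card_filter_manyRepeats_le`) and the transfer to the commutator subgroup (part 2, Sharp):

* **`card_inverseRepeats_ofFn`**, **`card_repeats_ofFn`** — the statistics of the word
  `List.ofFn w` are the statistics of the letter function `w : Fin n → α × Bool`.
* **`scl_lower_of_good`** — algebra: if `R_lin ≤ 2(ℓ₀+1)a` and `Rep ≤ (ℓ₀+1)a` then the bound of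
  part 7 gives `scl ≥ n/(12 ℓ₀) − 2(ℓ₀+1)²(a+1)`.
* **`scl_ge_of_good`**, **`card_filter_bad_le`**, **`card_filter_scl_lt_le`** — the per-length
  bound: eventually for all even `n`, every `ℓ₀ ≥ 1`, `a ≥ 0`,
  `#{w ∈ F_n' : scl(w) < n/(12ℓ₀) − 2(ℓ₀+1)²(a+1)} ≤ 6(n+1)^k(ℓ₀+1) exp(E) |F_n'|`,
  `E = (n/(ℓ₀+1)) · n(2k−1)^{−(ℓ₀+1)} · (e−1) − a`.
* **`eventually_windowLength`**, **`exp_exponent_le`**, **`transfer_factor_le`**,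
  **`polylog_error_le`** — the asymptotics of the parameters `ℓ₀ = ⌊(1+δ) log n / log(2k−1)⌋`,
  `a = (e−1) n^{1−δ} + (C+k+3) log n`.
* **`CalegariWalker2013_sclLowerTail`** — the main result of this file: for `k ≥ 2`, `ε > 0`,
  `C > 1` there is `K` with, for all large `n`,
  `#{w ∈ F_n' : scl(w) · log n / n < log(2k−1)/12 − ε} ≤ K n^{−C} |F_n'|`.
-/

noncomputable section

open Filter Topology

namespace Literature.GroupTheory.CombinatorialGroupTheory

section OfFn

/-- The inverse-repeat statistic of `List.ofFn w` is that of `w`. [folklore] -/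
theorem card_inverseRepeats_ofFn {α : Type*} [DecidableEq α] {n : ℕ} (w : Fin n → α × Bool)
    (ℓ₀ : ℕ) :
    ((Finset.univ : Finset (Fin ((List.ofFn w).length - ℓ₀))).filter
        fun i : Fin ((List.ofFn w).length - ℓ₀) =>
          ∃ i' : Fin ((List.ofFn w).length - ℓ₀), ∀ q : Fin (ℓ₀ + 1),
            (List.ofFn w).get ⟨i + q, by omega⟩ =
              (((List.ofFn w).get ⟨i' + (ℓ₀ - q), by omega⟩).1,
                !((List.ofFn w).get ⟨i' + (ℓ₀ - q), by omega⟩).2)).card =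
      ((Finset.univ : Finset (Fin (n - ℓ₀))).filter fun i : Fin (n - ℓ₀) =>
        ∃ i' : Fin (n - ℓ₀), ∀ q : Fin (ℓ₀ + 1), w ⟨i + q, by omega⟩ =
          ((w ⟨i' + (ℓ₀ - q), by omega⟩).1, !(w ⟨i' + (ℓ₀ - q), by omega⟩).2)).card := by
  classical
  have hn : (List.ofFn w).length = n := List.length_ofFn
  refine Finset.card_bij (fun i _ => ⟨(i : ℕ), by omega⟩) ?_ ?_ ?_
  · intro i hi
    rw [Finset.mem_filter] at hi ⊢
    obtain ⟨_, i', hwin⟩ := hi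
    refine ⟨Finset.mem_univ _, ⟨(i' : ℕ), by omega⟩, fun q => ?_⟩
    have h := hwin q
    simp only [List.get_eq_getElem, List.getElem_ofFn] at h
    exact h
  · intro i _ i₂ _ h
    exact Fin.ext (by simpa using congrArg Fin.val h)
  · intro j hj
    rw [Finset.mem_filter] at hj
    obtain ⟨_, j', hwin⟩ := hj
    refine ⟨⟨(j : ℕ), by omega⟩, ?_, rfl⟩
    rw [Finset.mem_filter]
    refine ⟨Finset.mem_univ _, ⟨(j' : ℕ), by omega⟩, fun q => ?_⟩
    simp only [List.get_eq_getElem, List.getElem_ofFn]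
    exact hwin q

/-- The repeat statistic of `List.ofFn w` is that of `w`. [folklore] -/
theorem card_repeats_ofFn {α : Type*} [DecidableEq α] {n : ℕ} (w : Fin n → α × Bool) (ℓ₀ : ℕ) :
    ((Finset.univ : Finset (Fin ((List.ofFn w).length - ℓ₀))).filter
        fun i : Fin ((List.ofFn w).length - ℓ₀) =>
          ∃ i'' : Fin ((List.ofFn w).length - ℓ₀), i'' < i ∧ ∀ q : Fin (ℓ₀ + 1),
            (List.ofFn w).get ⟨i'' + q, by omega⟩ = (List.ofFn w).get ⟨i + q, by omega⟩).card =
      ((Finset.univ : Finset (Fin (n - ℓ₀))).filter fun J : Fin (n - ℓ₀) =>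
        ∃ i' : Fin (n - ℓ₀), i' < J ∧ (fun q : Fin (ℓ₀ + 1) => w ⟨i' + q, by omega⟩) =
          fun q : Fin (ℓ₀ + 1) => w ⟨J + q, by omega⟩).card := by
  classical
  have hn : (List.ofFn w).length = n := List.length_ofFn
  refine Finset.card_bij (fun i _ => ⟨(i : ℕ), by omega⟩) ?_ ?_ ?_
  · intro i hi
    rw [Finset.mem_filter] at hi ⊢
    obtain ⟨_, i'', hlt, hwin⟩ := hi
    have hlt' : (i'' : ℕ) < i := hlt
    refine ⟨Finset.mem_univ _, ⟨(i'' : ℕ), by omega⟩, ?_, funext fun q => ?_⟩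
    · rw [Fin.mk_lt_mk]
      exact hlt'
    have h := hwin q
    simp only [List.get_eq_getElem, List.getElem_ofFn] at h
    exact h
  · intro i _ i₂ _ h
    exact Fin.ext (by simpa using congrArg Fin.val h)
  · intro j hj
    rw [Finset.mem_filter] at hj
    obtain ⟨_, j', hlt, hwin⟩ := hj
    have hlt' : (j' : ℕ) < j := hlt
    refine ⟨⟨(j : ℕ), by omega⟩, ?_, rfl⟩
    rw [Finset.mem_filter]
    refine ⟨Finset.mem_univ _, ⟨(j' : ℕ), by omega⟩, ?_, fun q => ?_⟩
    · show (⟨(j' : ℕ), _⟩ : Fin _) < ⟨(j : ℕ), _⟩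
      rw [Fin.mk_lt_mk]
      exact hlt'
    simp only [List.get_eq_getElem, List.getElem_ofFn]
    exact congrFun hwin q

end OfFn

section Algebra

/-- **The good-word inequality.** If the inverse-repeat and repeat statistics satisfy
`0 ≤ R_lin ≤ 2(ℓ₀+1)a` and `Rep ≤ (ℓ₀+1)a` (`a ≥ 0`, `ℓ₀ ≥ 1`), then the bound of
`stableCommutatorLength_ge_of_isReduced` yields `scl ≥ n/(12 ℓ₀) − 2(ℓ₀+1)²(a+1)`. [folklore] -/
theorem scl_lower_of_good (n : ℝ) (ℓ₀ : ℕ) (hℓ : 1 ≤ ℓ₀) (a Rl Rep s : ℝ) (ha : 0 ≤ a)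
    (hRl0 : 0 ≤ Rl) (hRl : Rl ≤ 2 * ((ℓ₀ : ℝ) + 1) * a) (hRep : Rep ≤ ((ℓ₀ : ℝ) + 1) * a)
    (hs : (n - 2 * (Rl + ℓ₀)) / (12 * ℓ₀) - (Rl + 2 * ℓ₀ + ℓ₀ * Rep) / 12 ≤ s) :
    n / (12 * ℓ₀) - 2 * ((ℓ₀ : ℝ) + 1) ^ 2 * (a + 1) ≤ s := by
  have hℓR : (1 : ℝ) ≤ ℓ₀ := by exact_mod_cast hℓ
  have hℓpos : (0 : ℝ) < ℓ₀ := by linarith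
  have e : (n - 2 * (Rl + ℓ₀)) / (12 * ℓ₀) = n / (12 * ℓ₀) - (Rl + ℓ₀) / (6 * ℓ₀) := by
    field_simp
    ring
  rw [e] at hs
  have h1 : (Rl + ℓ₀) / (6 * ℓ₀) ≤ a + 1 := by
    rw [div_le_iff₀ (by positivity)]
    nlinarith
  have h2 : (Rl + 2 * ℓ₀ + ℓ₀ * Rep) / 12 ≤ ((ℓ₀ : ℝ) + 1) ^ 2 * (a + 1) := by
    rw [div_le_iff₀ (by norm_num)]
    have := mul_le_mul_of_nonneg_left hRep hℓpos.le
    nlinarith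
  have h3 : a + 1 ≤ ((ℓ₀ : ℝ) + 1) ^ 2 * (a + 1) := by
    have : (1 : ℝ) ≤ ((ℓ₀ : ℝ) + 1) ^ 2 := by nlinarith
    nlinarith
  linarith

end Algebra

section PerLength

open scoped Classical

/-- **Good words have large scl.** For `k ≥ 1`, `1 ≤ ℓ₀`, `ℓ₀ + 1 ≤ n`, `a ≥ 0`: a reduced word of
length `n` in the commutator subgroup whose inverse-repeat statistic is `< 2(ℓ₀+1)a` and whose
repeat statistic is `< (ℓ₀+1)a` has `scl ≥ n/(12 ℓ₀) − 2(ℓ₀+1)²(a+1)`.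
[cite: CalegariWalker2013, Prop. 5.4 (deterministic form)] -/
theorem scl_ge_of_good {k n ℓ₀ : ℕ} (hℓ : 1 ≤ ℓ₀) (hn : 1 ≤ n) {a : ℝ} (ha : 0 ≤ a)
    {w : Fin n → Fin k × Bool} (hw : w ∈ commutatorWords k n)
    (hRl : (((Finset.univ : Finset (Fin (n - ℓ₀))).filter fun i : Fin (n - ℓ₀) =>
      ∃ i' : Fin (n - ℓ₀), ∀ q : Fin (ℓ₀ + 1), w ⟨i + q, by omega⟩ =
        ((w ⟨i' + (ℓ₀ - q), by omega⟩).1, !(w ⟨i' + (ℓ₀ - q), by omega⟩).2)).card : ℝ) <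
      2 * (((ℓ₀ : ℝ) + 1) * a))
    (hRep : (((Finset.univ : Finset (Fin (n - ℓ₀))).filter fun J : Fin (n - ℓ₀) =>
      ∃ i' : Fin (n - ℓ₀), i' < J ∧ (fun q : Fin (ℓ₀ + 1) => w ⟨i' + q, by omega⟩) =
        fun q : Fin (ℓ₀ + 1) => w ⟨J + q, by omega⟩).card : ℝ) < ((ℓ₀ : ℝ) + 1) * a) :
    (n : ℝ) / (12 * ℓ₀) - 2 * ((ℓ₀ : ℝ) + 1) ^ 2 * (a + 1) ≤
      stableCommutatorLength (FreeGroup.mk (List.ofFn w)) := by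
  rw [mem_commutatorWords_iff] at hw
  obtain ⟨hred, hcomm⟩ := hw
  have hred' : FreeGroup.IsReduced (List.ofFn w) := FreeGroup.isReduced_iff_reduce_eq.mpr hred
  have hne : List.ofFn w ≠ [] := by
    intro h
    have := congrArg List.length h
    rw [List.length_ofFn, List.length_nil] at this
    omega
  have hs := stableCommutatorLength_ge_of_isReduced (List.ofFn w) hne hred' hcomm ℓ₀ hℓ
  rw [card_inverseRepeats_ofFn, card_repeats_ofFn] at hs
  simp only [List.length_ofFn] at hs
  exact scl_lower_of_good n ℓ₀ hℓ a _ _ _ ha (Nat.cast_nonneg _) (by linarith) (by linarith) hs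

/-- **The bad words are few (finite form).** For `k ≥ 1`, `ℓ₀`, `a`: the number of reduced words of
length `n` with inverse-repeat statistic `≥ 2(ℓ₀+1)a` or repeat statistic `≥ (ℓ₀+1)a` is at most
`3(ℓ₀+1) |F_n| exp((n/(ℓ₀+1)) · n(2k−1)^{−(ℓ₀+1)} · (e − 1) − a)`.
[cite: CalegariWalker2013, Prop. 2.6 and Prop. 2.11] -/
theorem card_filter_bad_le (k n ℓ₀ : ℕ) (hk : 1 ≤ k) (a : ℝ) :
    (((reducedWords k n).filter fun w =>
        ¬ ((((Finset.univ : Finset (Fin (n - ℓ₀))).filter fun i : Fin (n - ℓ₀) =>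
            ∃ i' : Fin (n - ℓ₀), ∀ q : Fin (ℓ₀ + 1), w ⟨i + q, by omega⟩ =
              ((w ⟨i' + (ℓ₀ - q), by omega⟩).1, !(w ⟨i' + (ℓ₀ - q), by omega⟩).2)).card : ℝ) <
            2 * (((ℓ₀ : ℝ) + 1) * a) ∧
          (((Finset.univ : Finset (Fin (n - ℓ₀))).filter fun J : Fin (n - ℓ₀) =>
            ∃ i' : Fin (n - ℓ₀), i' < J ∧ (fun q : Fin (ℓ₀ + 1) => w ⟨i' + q, by omega⟩) =
              fun q : Fin (ℓ₀ + 1) => w ⟨J + q, by omega⟩).card : ℝ) < ((ℓ₀ : ℝ) + 1) * a)).card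
        : ℝ) ≤
      3 * (((ℓ₀ : ℝ) + 1) * (reducedWords k n).card *
        Real.exp ((n : ℝ) / ((ℓ₀ : ℝ) + 1) * ((n : ℝ) / (2 * k - 1 : ℝ) ^ (ℓ₀ + 1)) *
          (Real.exp 1 - 1) - 1 * a)) := by
  have h1 := card_filter_inverseWindows_ge_le k n ℓ₀ hk zero_le_one a
  have h2 := card_filter_manyRepeats_le k n ℓ₀ hk zero_le_one a
  have hsub : ((reducedWords k n).filter fun w =>
        ¬ ((((Finset.univ : Finset (Fin (n - ℓ₀))).filter fun i : Fin (n - ℓ₀) =>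
            ∃ i' : Fin (n - ℓ₀), ∀ q : Fin (ℓ₀ + 1), w ⟨i + q, by omega⟩ =
              ((w ⟨i' + (ℓ₀ - q), by omega⟩).1, !(w ⟨i' + (ℓ₀ - q), by omega⟩).2)).card : ℝ) <
            2 * (((ℓ₀ : ℝ) + 1) * a) ∧
          (((Finset.univ : Finset (Fin (n - ℓ₀))).filter fun J : Fin (n - ℓ₀) =>
            ∃ i' : Fin (n - ℓ₀), i' < J ∧ (fun q : Fin (ℓ₀ + 1) => w ⟨i' + q, by omega⟩) =
              fun q : Fin (ℓ₀ + 1) => w ⟨J + q, by omega⟩).card : ℝ) < ((ℓ₀ : ℝ) + 1) * a)) ⊆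
      ((reducedWords k n).filter fun w => 2 * (((ℓ₀ : ℝ) + 1) * a) ≤
        (((Finset.univ : Finset (Fin (n - ℓ₀))).filter fun i : Fin (n - ℓ₀) => ∃ i' : Fin (n - ℓ₀),
          ∀ q : Fin (ℓ₀ + 1), w ⟨i + q, by omega⟩ =
            ((w ⟨i' + (ℓ₀ - q), by omega⟩).1, !(w ⟨i' + (ℓ₀ - q), by omega⟩).2)).card : ℝ)) ∪
      ((reducedWords k n).filter fun w => ((ℓ₀ : ℝ) + 1) * a ≤
        (((Finset.univ : Finset (Fin (n - ℓ₀))).filter fun J : Fin (n - ℓ₀) => ∃ i' : Fin (n - ℓ₀),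
          i' < J ∧ (fun q : Fin (ℓ₀ + 1) => w ⟨i' + q, by omega⟩) =
            fun q : Fin (ℓ₀ + 1) => w ⟨J + q, by omega⟩).card : ℝ)) := by
    intro w hw
    rw [Finset.mem_filter] at hw
    obtain ⟨hwred, hbad⟩ := hw
    rw [Finset.mem_union, Finset.mem_filter, Finset.mem_filter]
    by_contra hcon
    rw [not_or, not_and, not_and, not_le, not_le] at hcon
    exact hbad ⟨hcon.1 hwred, hcon.2 hwred⟩
  have hcard := (Finset.card_le_card hsub).trans (Finset.card_union_le _ _)
  have hcard' := (Nat.cast_le (α := ℝ)).mpr hcard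
  rw [Nat.cast_add] at hcard'
  linarith

/-- **Per-length lower-tail bound, before asymptotics.** For `k ≥ 2` and eventually all even `n`:
for every `1 ≤ ℓ₀` and `a ≥ 0`, the words of `F_n'` with
`scl < n/(12 ℓ₀) − 2(ℓ₀+1)²(a+1)` number at most
`6 (n+1)^k (ℓ₀+1) exp((n/(ℓ₀+1)) · n(2k−1)^{−(ℓ₀+1)} · (e − 1) − a) · |F_n'|`.
[cite: CalegariWalker2013, Prop. 5.4 and Thm 2.1 (transfer)] -/
theorem card_filter_scl_lt_le (k : ℕ) (hk : 2 ≤ k) :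
    ∀ᶠ n : ℕ in atTop, Even n → ∀ ℓ₀ : ℕ, 1 ≤ ℓ₀ → ∀ a : ℝ, 0 ≤ a →
      ((((commutatorWords k n).filter fun w =>
          stableCommutatorLength (FreeGroup.mk (List.ofFn w)) <
            (n : ℝ) / (12 * ℓ₀) - 2 * ((ℓ₀ : ℝ) + 1) ^ 2 * (a + 1)).card : ℕ) : ℝ) ≤
        6 * ((n : ℝ) + 1) ^ k * ((ℓ₀ : ℝ) + 1) *
          Real.exp ((n : ℝ) / ((ℓ₀ : ℝ) + 1) * ((n : ℝ) / (2 * k - 1 : ℝ) ^ (ℓ₀ + 1)) *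
            (Real.exp 1 - 1) - 1 * a) * ((commutatorWords k n).card : ℝ) := by
  filter_upwards [transfer_to_commutatorWords k hk, Filter.eventually_ge_atTop 1] with n htr hn1
    heven ℓ₀ hℓ a ha
  -- the bad set (kept opaque, so that all its filters use the classical instance)
  set bad : (Fin n → Fin k × Bool) → Prop := fun w =>
    ¬ ((((Finset.univ : Finset (Fin (n - ℓ₀))).filter fun i : Fin (n - ℓ₀) =>
        ∃ i' : Fin (n - ℓ₀), ∀ q : Fin (ℓ₀ + 1), w ⟨i + q, by omega⟩ =
          ((w ⟨i' + (ℓ₀ - q), by omega⟩).1, !(w ⟨i' + (ℓ₀ - q), by omega⟩).2)).card : ℝ) <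
        2 * (((ℓ₀ : ℝ) + 1) * a) ∧
      (((Finset.univ : Finset (Fin (n - ℓ₀))).filter fun J : Fin (n - ℓ₀) =>
        ∃ i' : Fin (n - ℓ₀), i' < J ∧ (fun q : Fin (ℓ₀ + 1) => w ⟨i' + q, by omega⟩) =
          fun q : Fin (ℓ₀ + 1) => w ⟨J + q, by omega⟩).card : ℝ) < ((ℓ₀ : ℝ) + 1) * a)
    with hbad_def
  clear_value bad
  -- words with small scl are bad
  have hsub : ((commutatorWords k n).filter fun w =>
      stableCommutatorLength (FreeGroup.mk (List.ofFn w)) <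
        (n : ℝ) / (12 * ℓ₀) - 2 * ((ℓ₀ : ℝ) + 1) ^ 2 * (a + 1)) ⊆
      (commutatorWords k n).filter fun w => bad w := by
    intro w hw
    rw [Finset.mem_filter] at hw ⊢
    refine ⟨hw.1, ?_⟩
    rw [hbad_def]
    intro hgood
    have := scl_ge_of_good hℓ hn1 ha hw.1 hgood.1 hgood.2
    linarith [hw.2]
  have h1 : ((((commutatorWords k n).filter fun w =>
      stableCommutatorLength (FreeGroup.mk (List.ofFn w)) <
        (n : ℝ) / (12 * ℓ₀) - 2 * ((ℓ₀ : ℝ) + 1) ^ 2 * (a + 1)).card : ℕ) : ℝ) ≤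
      (((commutatorWords k n).filter fun w => bad w).card : ℝ) :=
    (Nat.cast_le (α := ℝ)).mpr (Finset.card_le_card hsub)
  -- transfer and the bound on reduced words
  have htr' := htr heven bad
  have hbad : (((reducedWords k n).filter fun w => bad w).card : ℝ) ≤
      3 * (((ℓ₀ : ℝ) + 1) * (reducedWords k n).card *
        Real.exp ((n : ℝ) / ((ℓ₀ : ℝ) + 1) * ((n : ℝ) / (2 * k - 1 : ℝ) ^ (ℓ₀ + 1)) *
          (Real.exp 1 - 1) - 1 * a)) := by
    have h := card_filter_bad_le k n ℓ₀ (by omega) a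
    subst hbad_def
    convert h using 4
  -- `|F_n| > 0`
  have hFpos : (0 : ℝ) < (reducedWords k n).card := by
    have h := card_reducedWords k hn1
    have : 0 < (reducedWords k n).card := by
      rw [h]
      exact Nat.mul_pos (by omega) (Nat.pow_pos (by omega))
    exact_mod_cast this
  refine h1.trans ?_
  -- divide the transfer inequality by `|F_n|`
  have key : (((commutatorWords k n).filter fun w => bad w).card : ℝ) ≤
      2 * ((n : ℝ) + 1) ^ k * (3 * (((ℓ₀ : ℝ) + 1) *
        Real.exp ((n : ℝ) / ((ℓ₀ : ℝ) + 1) * ((n : ℝ) / (2 * k - 1 : ℝ) ^ (ℓ₀ + 1)) *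
          (Real.exp 1 - 1) - 1 * a))) * ((commutatorWords k n).card : ℝ) := by
    refine le_of_mul_le_mul_right ?_ hFpos
    refine htr'.trans ?_
    have hpos : (0 : ℝ) ≤ 2 * ((n : ℝ) + 1) ^ k := by positivity
    have hC : (0 : ℝ) ≤ ((commutatorWords k n).card : ℝ) := Nat.cast_nonneg _
    calc 2 * ((n : ℝ) + 1) ^ k * (((reducedWords k n).filter fun w => bad w).card : ℝ) *
          ((commutatorWords k n).card : ℝ)
        ≤ 2 * ((n : ℝ) + 1) ^ k * (3 * (((ℓ₀ : ℝ) + 1) * (reducedWords k n).card *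
            Real.exp ((n : ℝ) / ((ℓ₀ : ℝ) + 1) * ((n : ℝ) / (2 * k - 1 : ℝ) ^ (ℓ₀ + 1)) *
              (Real.exp 1 - 1) - 1 * a))) * ((commutatorWords k n).card : ℝ) := by
          apply mul_le_mul_of_nonneg_right _ hC
          exact mul_le_mul_of_nonneg_left hbad hpos
      _ = _ := by ring
  refine key.trans (le_of_eq ?_)
  ring

end PerLength

section Asymptotics

/-- `n^{-c} → 0`: eventually `n^{-c} ≤ B` for any `B > 0`. [folklore] -/
theorem eventually_rpow_neg_le {c B : ℝ} (hc : 0 < c) (hB : 0 < B) :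
    ∀ᶠ n : ℕ in atTop, (n : ℝ) ^ (-c) ≤ B := by
  have h := (tendsto_rpow_neg_atTop hc).comp tendsto_natCast_atTop_atTop
  have h' := h.eventually (ge_mem_nhds hB)
  filter_upwards [h'] with n hn
  exact hn

/-- `log 3 > 1`. [folklore] -/
theorem one_lt_log_three : (1 : ℝ) < Real.log 3 := by
  rw [Real.lt_log_iff_exp_lt (by norm_num)]
  exact Real.exp_one_lt_three

/-- **The window-length parameter.** For `q ≥ 3` and `1 ≤ L ≤ 2`, with
`ℓ₀(n) = ⌊L log n / log q⌋`: eventually `1 ≤ ℓ₀`, `ℓ₀ ≤ L log n / log q`, `ℓ₀ + 1 ≤ 3 log n`,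
`1 ≤ log n`, and `n^L ≤ q^{ℓ₀ + 1}`. [folklore] -/
theorem eventually_windowLength {q L : ℝ} (hq : 3 ≤ q) (hL1 : 1 ≤ L) (hL2 : L ≤ 2) :
    ∀ᶠ n : ℕ in atTop, 1 ≤ ⌊L * Real.log n / Real.log q⌋₊ ∧
      (⌊L * Real.log n / Real.log q⌋₊ : ℝ) ≤ L * Real.log n / Real.log q ∧
      (⌊L * Real.log n / Real.log q⌋₊ : ℝ) + 1 ≤ 3 * Real.log n ∧
      1 ≤ Real.log n ∧
      (n : ℝ) ^ L ≤ q ^ (⌊L * Real.log n / Real.log q⌋₊ + 1) := by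
  have hlq : 1 < Real.log q := one_lt_log_three.trans_le (Real.log_le_log (by norm_num) hq)
  have hlq0 : 0 < Real.log q := by linarith
  have hqpos : 0 < q := by linarith
  -- `log n → ∞`
  have hlog : Tendsto (fun n : ℕ => Real.log n) atTop atTop :=
    Real.tendsto_log_atTop.comp tendsto_natCast_atTop_atTop
  filter_upwards [hlog.eventually_ge_atTop (Real.log q), hlog.eventually_ge_atTop 1,
    Filter.eventually_ge_atTop 1] with n hnq hn1 hnpos
  have hnR : (0 : ℝ) < n := by exact_mod_cast (show 0 < n by omega)
  set x := L * Real.log n / Real.log q with hx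
  have hx1 : 1 ≤ x := by
    rw [hx, le_div_iff₀ hlq0]
    nlinarith
  have hx0 : 0 ≤ x := by linarith
  have hfloor_le : (⌊x⌋₊ : ℝ) ≤ x := Nat.floor_le hx0
  have hlt : x < (⌊x⌋₊ : ℝ) + 1 := Nat.lt_floor_add_one x
  refine ⟨?_, hfloor_le, ?_, hn1, ?_⟩
  · exact Nat.le_floor (by exact_mod_cast hx1)
  · have hx2 : x ≤ 2 * Real.log n := by
      rw [hx, div_le_iff₀ hlq0]
      have h0 : 0 ≤ Real.log n := by linarith
      nlinarith
    linarith
  · -- `n^L = exp(L log n) ≤ exp((⌊x⌋+1) log q) = q^(⌊x⌋+1)`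
    rw [Real.rpow_def_of_pos hnR, ← Real.rpow_natCast, Real.rpow_def_of_pos hqpos,
      Real.exp_le_exp]
    push_cast
    have : Real.log n * L = x * Real.log q := by
      rw [hx]; field_simp
    rw [this, mul_comm x]
    exact mul_le_mul_of_nonneg_left hlt.le hlq0.le

/-- **The exponent.** With `n^L ≤ q^{ℓ₀+1}`, `L = 1 + δ`, and
`a = (e − 1) n^{1−δ} + D log n`: `exp((n/(ℓ₀+1)) (n/q^{ℓ₀+1}) (e−1) − a) ≤ n^{−D}`. [folklore] -/
theorem exp_exponent_le {n ℓ₀ : ℕ} {q δ D : ℝ} (hn : 1 ≤ n) (hq : 0 < q)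
    (hnL : (n : ℝ) ^ (1 + δ) ≤ q ^ (ℓ₀ + 1)) :
    Real.exp ((n : ℝ) / ((ℓ₀ : ℝ) + 1) * ((n : ℝ) / q ^ (ℓ₀ + 1)) * (Real.exp 1 - 1) -
        1 * ((Real.exp 1 - 1) * (n : ℝ) ^ (1 - δ) + D * Real.log n)) ≤
      (n : ℝ) ^ (-D) := by
  have hnR : (0 : ℝ) < n := by exact_mod_cast (show 0 < n by omega)
  have he : 0 ≤ Real.exp 1 - 1 := by linarith [Real.add_one_le_exp (1 : ℝ)]
  -- `n/(ℓ₀+1) ≤ n` and `n/q^(ℓ₀+1) ≤ n^{1-L} = n^{-δ}`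
  have h1 : (n : ℝ) / ((ℓ₀ : ℝ) + 1) ≤ n := by
    rw [div_le_iff₀ (by positivity)]
    have : (0 : ℝ) ≤ ℓ₀ := Nat.cast_nonneg _
    nlinarith
  have hnLpos : (0 : ℝ) < (n : ℝ) ^ (1 + δ) := Real.rpow_pos_of_pos hnR _
  have h2 : (n : ℝ) / q ^ (ℓ₀ + 1) ≤ (n : ℝ) ^ (-δ) := by
    calc (n : ℝ) / q ^ (ℓ₀ + 1) ≤ (n : ℝ) / (n : ℝ) ^ (1 + δ) :=
          div_le_div_of_nonneg_left hnR.le hnLpos hnL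
      _ = (n : ℝ) ^ (-δ) := by
          rw [div_eq_iff hnLpos.ne', ← Real.rpow_add hnR]
          norm_num
  have h3 : (n : ℝ) / ((ℓ₀ : ℝ) + 1) * ((n : ℝ) / q ^ (ℓ₀ + 1)) * (Real.exp 1 - 1) ≤
      (Real.exp 1 - 1) * (n : ℝ) ^ (1 - δ) := by
    have hprod : (n : ℝ) / ((ℓ₀ : ℝ) + 1) * ((n : ℝ) / q ^ (ℓ₀ + 1)) ≤ (n : ℝ) * (n : ℝ) ^ (-δ) :=
      mul_le_mul h1 h2 (by positivity) hnR.le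
    have e : (n : ℝ) * (n : ℝ) ^ (-δ) = (n : ℝ) ^ (1 - δ) := by
      rw [Real.rpow_neg hnR.le, Real.rpow_sub hnR, Real.rpow_one, div_eq_mul_inv]
    rw [e] at hprod
    nlinarith
  calc Real.exp ((n : ℝ) / ((ℓ₀ : ℝ) + 1) * ((n : ℝ) / q ^ (ℓ₀ + 1)) * (Real.exp 1 - 1) -
        1 * ((Real.exp 1 - 1) * (n : ℝ) ^ (1 - δ) + D * Real.log n))
      ≤ Real.exp (-(D * Real.log n)) := Real.exp_le_exp.mpr (by linarith)
    _ = (n : ℝ) ^ (-D) := by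
        rw [Real.rpow_def_of_pos hnR]
        congr 1
        ring

/-- **The transfer factor.** `6 (n+1)^k (ℓ₀+1) n^{−(C+k+3)} ≤ n^{−C}` as soon as
`ℓ₀ + 1 ≤ 3 log n` and `n² ≥ 18 · 2^k`. [folklore] -/
theorem transfer_factor_le {n k ℓ₀ : ℕ} {C : ℝ} (hn : 1 ≤ n) (hℓ : (ℓ₀ : ℝ) + 1 ≤ 3 * Real.log n)
    (hsmall : (n : ℝ) ^ (-(2 : ℝ)) ≤ 1 / (18 * 2 ^ k)) :
    6 * ((n : ℝ) + 1) ^ k * ((ℓ₀ : ℝ) + 1) * (n : ℝ) ^ (-(C + k + 3)) ≤ (n : ℝ) ^ (-C) := by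
  have hnR : (0 : ℝ) < n := by exact_mod_cast (show 0 < n by omega)
  have hn1 : (1 : ℝ) ≤ n := by exact_mod_cast hn
  -- `(n+1)^k ≤ 2^k n^k`, `ℓ₀ + 1 ≤ 3 n`
  have hpow : ((n : ℝ) + 1) ^ k ≤ 2 ^ k * (n : ℝ) ^ k := by
    rw [← mul_pow]
    exact pow_le_pow_left₀ (by positivity) (by linarith) k
  have hlog : Real.log n ≤ n := (Real.log_le_sub_one_of_pos hnR).trans (by linarith)
  have hℓ' : (ℓ₀ : ℝ) + 1 ≤ 3 * n := hℓ.trans (by linarith)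
  -- rewrite everything as real powers of `n`
  have e1 : (n : ℝ) ^ k * (n : ℝ) * (n : ℝ) ^ (-(C + k + 3)) = (n : ℝ) ^ (-(2 : ℝ)) * (n : ℝ) ^ (-C) := by
    rw [← Real.rpow_natCast, show (n : ℝ) ^ (k : ℝ) * (n : ℝ) = (n : ℝ) ^ (k : ℝ) * (n : ℝ) ^ (1 : ℝ)
      by rw [Real.rpow_one], ← Real.rpow_add hnR, ← Real.rpow_add hnR, ← Real.rpow_add hnR]
    congr 1
    ring
  have hpos1 : (0 : ℝ) ≤ (n : ℝ) ^ (-(C + k + 3)) := (Real.rpow_pos_of_pos hnR _).le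
  have hposC : (0 : ℝ) ≤ (n : ℝ) ^ (-C) := (Real.rpow_pos_of_pos hnR _).le
  calc 6 * ((n : ℝ) + 1) ^ k * ((ℓ₀ : ℝ) + 1) * (n : ℝ) ^ (-(C + k + 3))
      ≤ 6 * (2 ^ k * (n : ℝ) ^ k) * (3 * n) * (n : ℝ) ^ (-(C + k + 3)) := by
        apply mul_le_mul_of_nonneg_right _ hpos1
        apply mul_le_mul (mul_le_mul_of_nonneg_left hpow (by norm_num)) hℓ' (by positivity)
          (by positivity)
    _ = 18 * 2 ^ k * ((n : ℝ) ^ k * (n : ℝ) * (n : ℝ) ^ (-(C + k + 3))) := by ring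
    _ = 18 * 2 ^ k * ((n : ℝ) ^ (-(2 : ℝ)) * (n : ℝ) ^ (-C)) := by rw [e1]
    _ ≤ 18 * 2 ^ k * ((1 / (18 * 2 ^ k)) * (n : ℝ) ^ (-C)) := by
        apply mul_le_mul_of_nonneg_left _ (by positivity)
        exact mul_le_mul_of_nonneg_right hsmall hposC
    _ = (n : ℝ) ^ (-C) := by field_simp

/-- **The polylogarithmic error term.** With `η = δ/8`, `0 < δ`, `D ≥ 1`, `log n ≥ 1` and the
two smallness conditions `n^{−5δ/8} ≤ ε η³ / (72(e−1)+1)`, `n^{−(1−δ/2)} ≤ ε η⁴/(72 D)`: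
`36 log³ n ((e−1) n^{1−δ} + D log n) ≤ ε n`. (Via `log n ≤ n^η / η`.) [folklore] -/
theorem polylog_error_le {n : ℕ} {δ ε D : ℝ} (hδ : 0 < δ) (hε : 0 < ε)
    (hD : 1 ≤ D) (hlog : 1 ≤ Real.log n)
    (hs1 : (n : ℝ) ^ (-(5 * δ / 8)) ≤ ε * (δ / 8) ^ 3 / (72 * (Real.exp 1 - 1) + 1))
    (hs2 : (n : ℝ) ^ (-(1 - δ / 2)) ≤ ε * (δ / 8) ^ 4 / (72 * D)) :
    36 * Real.log n ^ 3 * ((Real.exp 1 - 1) * (n : ℝ) ^ (1 - δ) + D * Real.log n) ≤ ε * n := by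
  set η : ℝ := δ / 8 with hη
  have hηpos : 0 < η := by positivity
  have hn1 : (1 : ℝ) < n := by
    by_contra h
    rw [not_lt] at h
    have := Real.log_nonpos (Nat.cast_nonneg n) h
    linarith
  have hnR : (0 : ℝ) < n := by linarith
  have he : 0 ≤ Real.exp 1 - 1 := by linarith [Real.add_one_le_exp (1 : ℝ)]
  have hlog0 : 0 ≤ Real.log n := by linarith
  -- `log n ≤ n^η / η`
  have hlη : Real.log n ≤ (n : ℝ) ^ η / η := Real.log_le_rpow_div hnR.le hηpos
  have hl3 : Real.log n ^ 3 ≤ (n : ℝ) ^ (3 * η) / η ^ 3 := by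
    calc Real.log n ^ 3 ≤ ((n : ℝ) ^ η / η) ^ 3 := pow_le_pow_left₀ hlog0 hlη 3
      _ = (n : ℝ) ^ (3 * η) / η ^ 3 := by
          rw [div_pow, ← Real.rpow_natCast ((n : ℝ) ^ η) 3, ← Real.rpow_mul hnR.le]
          norm_num
          ring_nf
  have hl4 : Real.log n ^ 4 ≤ (n : ℝ) ^ (4 * η) / η ^ 4 := by
    calc Real.log n ^ 4 ≤ ((n : ℝ) ^ η / η) ^ 4 := pow_le_pow_left₀ hlog0 hlη 4
      _ = (n : ℝ) ^ (4 * η) / η ^ 4 := by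
          rw [div_pow, ← Real.rpow_natCast ((n : ℝ) ^ η) 4, ← Real.rpow_mul hnR.le]
          norm_num
          ring_nf
  -- first term: `36 (e-1) log³n · n^{1-δ} ≤ (ε/2) n`
  have hA : 36 * (Real.exp 1 - 1) * Real.log n ^ 3 * (n : ℝ) ^ (1 - δ) ≤ ε / 2 * n := by
    have hpos : (0 : ℝ) ≤ (n : ℝ) ^ (1 - δ) := (Real.rpow_pos_of_pos hnR _).le
    have step1 : 36 * (Real.exp 1 - 1) * Real.log n ^ 3 * (n : ℝ) ^ (1 - δ) ≤
        36 * (Real.exp 1 - 1) * ((n : ℝ) ^ (3 * η) / η ^ 3) * (n : ℝ) ^ (1 - δ) := by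
      apply mul_le_mul_of_nonneg_right _ hpos
      exact mul_le_mul_of_nonneg_left hl3 (by positivity)
    refine step1.trans ?_
    -- `n^{3η} n^{1-δ} = n · n^{-(5δ/8)}`
    have e : (n : ℝ) ^ (3 * η) * (n : ℝ) ^ (1 - δ) = (n : ℝ) * (n : ℝ) ^ (-(5 * δ / 8)) := by
      rw [← Real.rpow_add hnR, show (n : ℝ) * (n : ℝ) ^ (-(5 * δ / 8)) =
        (n : ℝ) ^ ((1 : ℝ) + -(5 * δ / 8)) by rw [Real.rpow_add hnR, Real.rpow_one]]
      congr 1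
      rw [hη]; ring
    have hs1' : 72 * (Real.exp 1 - 1) * (n : ℝ) ^ (-(5 * δ / 8)) ≤ ε * η ^ 3 := by
      have h := mul_le_mul_of_nonneg_left hs1 (show (0 : ℝ) ≤ 72 * (Real.exp 1 - 1) by positivity)
      refine h.trans ?_
      have hX : 0 ≤ ε * η ^ 3 := by positivity
      rw [mul_div_assoc', div_le_iff₀ (by positivity)]
      nlinarith [hX, he]
    have hη3 : (0 : ℝ) < η ^ 3 := pow_pos hηpos 3
    calc 36 * (Real.exp 1 - 1) * ((n : ℝ) ^ (3 * η) / η ^ 3) * (n : ℝ) ^ (1 - δ)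
        = (36 * (Real.exp 1 - 1) * (n : ℝ) ^ (-(5 * δ / 8))) * n / η ^ 3 := by
          rw [mul_div_assoc, mul_assoc, mul_assoc, div_mul_eq_mul_div, e]
          ring
      _ ≤ (ε * η ^ 3 / 2) * n / η ^ 3 := by
          apply div_le_div_of_nonneg_right _ hη3.le
          apply mul_le_mul_of_nonneg_right _ hnR.le
          linarith
      _ = ε / 2 * n := by field_simp
  -- second term: `36 D log⁴ n ≤ (ε/2) n`
  have hB : 36 * D * Real.log n ^ 4 ≤ ε / 2 * n := by
    have step1 : 36 * D * Real.log n ^ 4 ≤ 36 * D * ((n : ℝ) ^ (4 * η) / η ^ 4) :=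
      mul_le_mul_of_nonneg_left hl4 (by positivity)
    refine step1.trans ?_
    have e : (n : ℝ) ^ (4 * η) = (n : ℝ) * (n : ℝ) ^ (-(1 - δ / 2)) := by
      rw [show (n : ℝ) * (n : ℝ) ^ (-(1 - δ / 2)) = (n : ℝ) ^ ((1 : ℝ) + -(1 - δ / 2)) by
        rw [Real.rpow_add hnR, Real.rpow_one]]
      congr 1
      rw [hη]; ring
    have hD0 : 0 < D := by linarith
    have hs2' : 72 * D * (n : ℝ) ^ (-(1 - δ / 2)) ≤ ε * η ^ 4 := by
      have h := mul_le_mul_of_nonneg_left hs2 (show (0 : ℝ) ≤ 72 * D by positivity)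
      refine h.trans (le_of_eq ?_)
      rw [hη]
      field_simp
    have hη4 : (0 : ℝ) < η ^ 4 := pow_pos hηpos 4
    calc 36 * D * ((n : ℝ) ^ (4 * η) / η ^ 4)
        = (36 * D * (n : ℝ) ^ (-(1 - δ / 2))) * n / η ^ 4 := by rw [e]; ring
      _ ≤ (ε * η ^ 4 / 2) * n / η ^ 4 := by
          apply div_le_div_of_nonneg_right _ hη4.le
          apply mul_le_mul_of_nonneg_right _ hnR.le
          linarith
      _ = ε / 2 * n := by field_simp
  calc 36 * Real.log n ^ 3 * ((Real.exp 1 - 1) * (n : ℝ) ^ (1 - δ) + D * Real.log n)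
      = 36 * (Real.exp 1 - 1) * Real.log n ^ 3 * (n : ℝ) ^ (1 - δ) + 36 * D * Real.log n ^ 4 := by
        ring
    _ ≤ ε / 2 * n + ε / 2 * n := add_le_add hA hB
    _ = ε * n := by ring

end Asymptotics

section Final

open scoped Classical

/-- **Calegari–Walker Prop. 5.4: the lower tail of scl of a random word, constant `1/12`.**
For `k ≥ 2`, `ε > 0`, `C > 1` there is `K` such that for all large `n`, among the reduced words
`w` of length `n` in the commutator subgroup of `F_k` (uniform measure), those with
`scl(w) · log n / n < log(2k−1)/12 − ε` number at most `K n^{−C} |F_n'|`. (The printed proof uses a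
small counting quasimorphism and obtains an exponential bound; here: Bardakov's formula for
`cl(w'^M)`, Props. 2.6/2.11 for the edge statistics, and Sharp's transfer `|F_n| ≤ 2(n+1)^k |F_n'|`.
The sharp constant `1/6` of Theorem 4.1 requires the comb analysis of Prop. 4.9.)
[cite: CalegariWalker2013, Prop. 5.4] -/
theorem CalegariWalker2013_sclLowerTail (k : ℕ) (hk : 2 ≤ k) (ε : ℝ) (hε : 0 < ε) (C : ℝ)
    (hC : 1 < C) :
    ∃ K : ℝ, ∀ᶠ n : ℕ in atTop,
      ((((commutatorWords k n).filter fun w =>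
          stableCommutatorLength (FreeGroup.mk (List.ofFn w)) * Real.log n / n <
            Real.log (2 * k - 1) / 12 - ε).card : ℕ) : ℝ) ≤
        K * (n : ℝ) ^ (-C) * ((commutatorWords k n).card : ℝ) := by
  -- constants
  have hk2 : (2 : ℝ) ≤ k := by exact_mod_cast hk
  have hk0 : (0 : ℝ) ≤ k := by linarith
  have hq3 : (3 : ℝ) ≤ 2 * k - 1 := by linarith
  have hqpos : (0 : ℝ) < 2 * k - 1 := by linarith
  have hlq : 1 < Real.log (2 * k - 1) :=
    one_lt_log_three.trans_le (Real.log_le_log (by norm_num) hq3)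
  have hlq0 : 0 < Real.log (2 * k - 1) := by linarith
  have he : 0 ≤ Real.exp 1 - 1 := by linarith [Real.add_one_le_exp (1 : ℝ)]
  set δ : ℝ := min (1 / 2) (6 * ε / Real.log (2 * k - 1)) with hδdef
  have hδpos : 0 < δ := lt_min (by norm_num) (by positivity)
  have hδhalf : δ ≤ 1 / 2 := min_le_left _ _
  have hδε : Real.log (2 * k - 1) * δ ≤ 6 * ε := by
    have h : δ ≤ 6 * ε / Real.log (2 * k - 1) := min_le_right _ _
    rw [le_div_iff₀ hlq0] at h
    linarith
  refine ⟨1, ?_⟩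
  filter_upwards [card_filter_scl_lt_le k hk,
    eventually_windowLength (L := 1 + δ) hq3 (by linarith) (by linarith),
    eventually_rpow_neg_le (c := 5 * δ / 8) (B := ε * (δ / 8) ^ 3 / (72 * (Real.exp 1 - 1) + 1))
      (by positivity) (by positivity),
    eventually_rpow_neg_le (c := 1 - δ / 2) (B := ε * (δ / 8) ^ 4 / (72 * (C + k + 4)))
      (by linarith) (by apply div_pos (by positivity); linarith),
    eventually_rpow_neg_le (c := 2) (B := 1 / (18 * 2 ^ k)) (by norm_num) (by positivity),
    Filter.eventually_ge_atTop 1] with n hper hwin hs1 hs2 hs3 hn1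
  obtain ⟨hℓ1, hℓle, hℓ3, hlog1, hnL⟩ := hwin
  rcases Nat.even_or_odd n with heven | hodd
  swap
  · rw [commutatorWords_eq_empty_of_odd k hodd]
    simp
  have hnR : (0 : ℝ) < n := by exact_mod_cast (show 0 < n by omega)
  have hlogpos : 0 < Real.log n := by linarith
  -- the parameters for this `n`
  set ℓ₀ : ℕ := ⌊(1 + δ) * Real.log n / Real.log (2 * k - 1)⌋₊ with hℓ₀def
  set a : ℝ := (Real.exp 1 - 1) * (n : ℝ) ^ (1 - δ) + (C + k + 3) * Real.log n with hadef
  have hpow0 : (0 : ℝ) ≤ (n : ℝ) ^ (1 - δ) := (Real.rpow_pos_of_pos hnR _).le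
  have ha : 0 ≤ a := by
    rw [hadef]
    have : (0 : ℝ) ≤ C + k + 3 := by linarith
    positivity
  have hmain := hper heven ℓ₀ hℓ1 a ha
  -- the probability factor is `≤ n^{-C}`
  have hexp : Real.exp ((n : ℝ) / ((ℓ₀ : ℝ) + 1) * ((n : ℝ) / (2 * k - 1 : ℝ) ^ (ℓ₀ + 1)) *
      (Real.exp 1 - 1) - 1 * a) ≤ (n : ℝ) ^ (-(C + k + 3)) :=
    exp_exponent_le (ℓ₀ := ℓ₀) (δ := δ) (D := C + k + 3) hn1 hqpos hnL
  have htf := transfer_factor_le (k := k) (ℓ₀ := ℓ₀) (C := C) hn1 hℓ3 hs3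
  have hprob : 6 * ((n : ℝ) + 1) ^ k * ((ℓ₀ : ℝ) + 1) *
      Real.exp ((n : ℝ) / ((ℓ₀ : ℝ) + 1) * ((n : ℝ) / (2 * k - 1 : ℝ) ^ (ℓ₀ + 1)) *
        (Real.exp 1 - 1) - 1 * a) * ((commutatorWords k n).card : ℝ) ≤
      1 * (n : ℝ) ^ (-C) * ((commutatorWords k n).card : ℝ) := by
    apply mul_le_mul_of_nonneg_right _ (Nat.cast_nonneg _)
    rw [one_mul ((n : ℝ) ^ (-C))]
    refine le_trans ?_ htf
    exact mul_le_mul_of_nonneg_left hexp (by positivity)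
  -- the threshold: `(log q/12 - ε) n / log n ≤ n/(12 ℓ₀) - 2(ℓ₀+1)²(a+1)`
  have hD1 : n / (12 * (ℓ₀ : ℝ)) ≥ (Real.log (2 * k - 1) / 12 - ε / 2) * n / Real.log n := by
    have hℓpos : (0 : ℝ) < ℓ₀ := by exact_mod_cast (show 0 < ℓ₀ by omega)
    -- `n/(12 ℓ₀) ≥ n log q / (12 (1+δ) log n)`
    have h1 : (n : ℝ) * Real.log (2 * k - 1) / (12 * (1 + δ) * Real.log n) ≤ n / (12 * (ℓ₀ : ℝ)) := by
      rw [div_le_div_iff₀ (by positivity) (by positivity)]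
      have h := mul_le_mul_of_nonneg_left hℓle (show (0 : ℝ) ≤ 12 * n * Real.log (2 * k - 1) by
        positivity)
      calc (n : ℝ) * Real.log (2 * k - 1) * (12 * (ℓ₀ : ℝ))
          = 12 * n * Real.log (2 * k - 1) * (ℓ₀ : ℝ) := by ring
        _ ≤ 12 * n * Real.log (2 * k - 1) * ((1 + δ) * Real.log n / Real.log (2 * k - 1)) := h
        _ = n * (12 * (1 + δ) * Real.log n) := by field_simp
    -- `log q / (12 (1+δ)) ≥ log q / 12 - ε/2`
    have h2 : (Real.log (2 * k - 1) / 12 - ε / 2) * n / Real.log n ≤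
        (n : ℝ) * Real.log (2 * k - 1) / (12 * (1 + δ) * Real.log n) := by
      rw [div_le_div_iff₀ hlogpos (by positivity)]
      have h3 : (Real.log (2 * k - 1) / 12 - ε / 2) * (12 * (1 + δ)) ≤ Real.log (2 * k - 1) := by
        have hεδ : 0 ≤ ε * δ := by positivity
        have e3 : (Real.log (2 * k - 1) / 12 - ε / 2) * (12 * (1 + δ)) =
            Real.log (2 * k - 1) + Real.log (2 * k - 1) * δ - 6 * ε - 6 * (ε * δ) := by ring
        rw [e3]
        linarith
      have h4 : 0 ≤ (n : ℝ) * Real.log n := by positivity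
      calc (Real.log (2 * k - 1) / 12 - ε / 2) * n * (12 * (1 + δ) * Real.log n)
          = ((Real.log (2 * k - 1) / 12 - ε / 2) * (12 * (1 + δ))) * (n * Real.log n) := by ring
        _ ≤ Real.log (2 * k - 1) * (n * Real.log n) := mul_le_mul_of_nonneg_right h3 h4
        _ = n * Real.log (2 * k - 1) * Real.log n := by ring
    linarith
  have hD2 : 2 * ((ℓ₀ : ℝ) + 1) ^ 2 * (a + 1) ≤ ε / 2 * n / Real.log n := by
    have hpoly := polylog_error_le (n := n) (δ := δ) (ε := ε) (D := C + k + 4) hδpos hε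
      (by linarith) hlog1 hs1 hs2
    -- `a + 1 ≤ (e-1) n^{1-δ} + (C+k+4) log n`
    have ha1 : a + 1 ≤ (Real.exp 1 - 1) * (n : ℝ) ^ (1 - δ) + (C + k + 4) * Real.log n := by
      have e4 : (C + k + 4) * Real.log n = (C + k + 3) * Real.log n + Real.log n := by ring
      rw [hadef, e4]
      linarith
    have hsq : ((ℓ₀ : ℝ) + 1) ^ 2 ≤ 9 * Real.log n ^ 2 := by
      have h0 : 0 ≤ (ℓ₀ : ℝ) + 1 := by positivity
      calc ((ℓ₀ : ℝ) + 1) ^ 2 ≤ (3 * Real.log n) ^ 2 := pow_le_pow_left₀ h0 hℓ3 2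
        _ = 9 * Real.log n ^ 2 := by ring
    rw [le_div_iff₀ hlogpos]
    have hX : 0 ≤ (Real.exp 1 - 1) * (n : ℝ) ^ (1 - δ) + (C + k + 4) * Real.log n := by
      have : (0 : ℝ) ≤ C + k + 4 := by linarith
      positivity
    calc 2 * ((ℓ₀ : ℝ) + 1) ^ 2 * (a + 1) * Real.log n
        ≤ 2 * (9 * Real.log n ^ 2) * ((Real.exp 1 - 1) * (n : ℝ) ^ (1 - δ) +
            (C + k + 4) * Real.log n) * Real.log n := by
          apply mul_le_mul_of_nonneg_right _ hlogpos.le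
          apply mul_le_mul (mul_le_mul_of_nonneg_left hsq (by norm_num)) ha1 (by linarith)
            (by positivity)
      _ = (36 * Real.log n ^ 3 * ((Real.exp 1 - 1) * (n : ℝ) ^ (1 - δ) +
            (C + k + 4) * Real.log n)) / 2 := by ring
      _ ≤ ε * n / 2 := by linarith
      _ = ε / 2 * n := by ring
  have hthr : (Real.log (2 * k - 1) / 12 - ε) * n / Real.log n ≤
      (n : ℝ) / (12 * ℓ₀) - 2 * ((ℓ₀ : ℝ) + 1) ^ 2 * (a + 1) := by
    have e : (Real.log (2 * k - 1) / 12 - ε) * n / Real.log n =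
        (Real.log (2 * k - 1) / 12 - ε / 2) * n / Real.log n - ε / 2 * n / Real.log n := by
      field_simp
      ring
    rw [e]
    linarith
  -- the inclusion of events
  have hsub : ((commutatorWords k n).filter fun w =>
      stableCommutatorLength (FreeGroup.mk (List.ofFn w)) * Real.log n / n <
        Real.log (2 * k - 1) / 12 - ε) ⊆
      (commutatorWords k n).filter fun w =>
        stableCommutatorLength (FreeGroup.mk (List.ofFn w)) <
          (n : ℝ) / (12 * ℓ₀) - 2 * ((ℓ₀ : ℝ) + 1) ^ 2 * (a + 1) := by
    intro w hw
    rw [Finset.mem_filter] at hw ⊢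
    refine ⟨hw.1, lt_of_lt_of_le ?_ hthr⟩
    have h := hw.2
    rw [div_lt_iff₀ hnR] at h
    rw [lt_div_iff₀ hlogpos]
    linarith
  calc ((((commutatorWords k n).filter fun w =>
        stableCommutatorLength (FreeGroup.mk (List.ofFn w)) * Real.log n / n <
          Real.log (2 * k - 1) / 12 - ε).card : ℕ) : ℝ)
      ≤ ((((commutatorWords k n).filter fun w =>
          stableCommutatorLength (FreeGroup.mk (List.ofFn w)) <
            (n : ℝ) / (12 * ℓ₀) - 2 * ((ℓ₀ : ℝ) + 1) ^ 2 * (a + 1)).card : ℕ) : ℝ) :=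
        (Nat.cast_le (α := ℝ)).mpr (Finset.card_le_card hsub)
    _ ≤ _ := hmain
    _ ≤ _ := hprob

end Final


end Literature.GroupTheory.CombinatorialGroupTheory

end
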